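import Literature.AnabelianGeometry.EtaleTheta.Discharge.Sec4Remark411DescentEngines
import Literature.AnabelianGeometry.EtaleTheta.Discharge.Sec4Remark411DescentOfGaloisAction
import Literature.AnabelianGeometry.EtaleTheta.TemperedFrobenioidOfGaloisCoveringZTower
import Literature.AnabelianGeometry.EtaleTheta.TemperedFrobenioidOfTateTowerTheta

/-!
# [EtTh] Remark 4.1.1 HYPOTHESIS-FREE at the genuine towers: the ℤ-tower and the Tate (`Ÿ`) tower §4 settings over `B^temp(Π^tp_X)⁰`

S. Mochizuki, *The étale theta function …*, Publ. RIMS **45** (2009), Rmk. 4.1.1 p. 88 (PDF): «if `α : A → B` is of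
base-Frobenius type, then by applying Proposition 3.4, (ii), together with the factorization of [Mzk17], Definition 1.3,
(iv), (a), one verifies easily that `A → B` is a categorical quotient of `A` by the subgroup `G · μ_N(A) ⊆ Aut_C(A)` in the
full subcategory of `C` determined by the Frobenius-trivial objects» [cite: MochizukiEtTh2009, Rmk 4.1.1 p.88]; Def. 3.3 (iii)
p. 73; [SemiAnbd] Rmk. 3.1.3 p. 34 [cite: MochizukiSemiAnbd2006, Rmk 3.1.3 p.34].

abc-iut cell, layer L2 [EtTh], L-F row F-0729 (`BiKummerSetting.Remark411`: «instance forms open / model-witnessed»), seat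
abc-iut-w6-d047 (gen 5), row «RMK411@ZTOWER», FILE B.  PROOF-ONLY (0 definitions; nothing landed is edited).  RESULT:
**`ZTowerTempered.remark411_setting` — `(ZTowerTempered.setting X φ R S NH M).Remark411` with NO hypothesis**, and the same
for the Tate tower (`TateTowerTempered.remark411_setting`): [EtTh] Remark 4.1.1 AS TYPED (abc-iut-L2-t3's `Remark411`) holds at
the §4 settings of record whose base is the GENUINE connected temperoid `B^temp(Π^tp_X)⁰` AND whose divisor / function data are
the GENUINE Def. 3.3 (iii) data of the tower (abc-iut-w6-d058 / w5-d179 / w6-d048 lineages).  Until now the tree had Remark 4.1.1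
hypothesis-free only with CONSTANT divisor data over the genuine base (abc-iut-f-108 `Toy.remark411_biKummerSettingConnectedPart`)
and, at the towers, modulo the two descent binders `hΦdesc`, `hBdesc` of `remark411_ofConnectedPart_treeCatVocab_of_galoisDescent`.
Route: §1 transports the `Γ`-set descent of abc-iut-f-108 (`phiZero_existsUnique_descent` / `bZero_existsUnique_descent` along a
surjective DECK-TRANSITIVE covering map) to the small model `ofGaloisActionCosetCat` along the equivalence
`CosetCat Π ≌ B^temp(Π)⁰` (`CosetCat.equivConnectedPart`): arrows out of Galois objects are deck-transitive (FILE A §1), and every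
deck of the underlying `Γ`-set map comes from an automorphism of the covering over the arrow (the functors are fully faithful);
§2 feeds this into FILE A §2/§3 (descent of `Φ = im(Φ₀^pf → Φ₀^rlf)` and `B = B₀ ×_{(Φ₀^ℝ)^gp} Φ^gp` for `ofDiagonalBase`) and then
into abc-iut-f-108's reduction.  HONEST FRAMING: a theorem about OUR constructed tower data over OUR typed [SemiAnbd] interface
`TemperedArithmeticGroup`; refereed pre-IUT material; nothing here bears on [IUTchIII] Cor. 3.12; no side taken; typed ≠ proved;
nothing here asserts abc proved or refuted.
-/

noncomputable section

open CategoryTheory Opposite Function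

namespace Literature.AnabelianGeometry.EtaleTheta

open Literature.AlgebraicGeometry.Frobenioids Literature.AnabelianGeometry.SemiGraphs
  Literature.AlgebraicGeometry.Frobenioids.QuasiTemperoid.BTempConnected LogDivisorModel LogDivisorModel.GaloisAction

universe u

/-! ## §1 `Γ`-set descent transported to the small model `CosetCat Γ` along `CosetCat Γ ≌ B^temp(Γ)⁰` -/

namespace DivisorMonoids

section CosetDescent

variable {Γ : Type u} [Group Γ] [TopologicalSpace Γ] [IsTopologicalGroup Γ] (hΓ : IsTempered Γ)
  {Z : LogDivisorModel.{u}} (A : Z.GaloisAction Γ) (hZ : Z.CuspLaws)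

/-- **Descent data for an arrow out of a Galois object, read through `CosetCat Γ ≌ B^temp(Γ)⁰`.**  For `p : A₁ → B₁` in
`B^temp(Γ)⁰` with `A₁` Galois, write `F := (equivConnectedPart hΓ).inverse` and `p′ := toBTemp (F p) : Γ/U → Γ/V`: then (1) `Γ/U` is
Galois, (2) `p′` is surjective on points, (3) `p′` is deck-transitive for the `Γ`-SET automorphisms, and (4) every `Γ`-set
automorphism of `Γ/U` over `p′` is `toBTemp (F g)` for an automorphism `g` of `A₁` over `p`.
[cite: MochizukiSemiAnbd2006, Rmk 3.1.3 p.34] -/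
theorem cosetDescentData {A₁ B₁ : ConnectedPart (BTemp Γ)} (p : A₁ ⟶ B₁) (hA : IsGaloisObj A₁.obj) :
    let F := (CosetCat.equivConnectedPart hΓ).inverse
    IsGaloisObj ((CosetCat.toBTemp hΓ).obj (F.obj A₁)) ∧
    Surjective ((CosetCat.toBTemp hΓ).map (F.map p)).hom.hom ∧
    (∀ s₁ s₂ : ((CosetCat.toBTemp hΓ).obj (F.obj A₁)).obj.V,
        ((CosetCat.toBTemp hΓ).map (F.map p)).hom.hom s₁ = ((CosetCat.toBTemp hΓ).map (F.map p)).hom.hom s₂ →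
        ∃ σ : Aut ((CosetCat.toBTemp hΓ).obj (F.obj A₁)).obj,
          σ.hom ≫ ((CosetCat.toBTemp hΓ).map (F.map p)).hom = ((CosetCat.toBTemp hΓ).map (F.map p)).hom ∧
            σ.hom.hom s₁ = s₂) ∧
    (∀ σ : Aut ((CosetCat.toBTemp hΓ).obj (F.obj A₁)).obj,
        σ.hom ≫ ((CosetCat.toBTemp hΓ).map (F.map p)).hom = ((CosetCat.toBTemp hΓ).map (F.map p)).hom →
        ∃ g : Aut A₁, g.hom ≫ p = p ∧ ((CosetCat.toBTemp hΓ).map (F.map g.hom)).hom = σ.hom) := by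
  intro F
  haveI := CosetCat.toBTemp_full hΓ
  haveI := CosetCat.toBTemp_faithful hΓ
  -- `Γ/U ≅ A₁` in `B^temp(Γ)`, hence Galois
  let e₁ : (CosetCat.toBTemp hΓ).obj (F.obj A₁) ≅ A₁.obj :=
    (connectedObjects (BTemp Γ)).ι.mapIso ((CosetCat.equivConnectedPart hΓ).counitIso.app A₁)
  have hA' : IsGaloisObj ((CosetCat.toBTemp hΓ).obj (F.obj A₁)) := by
    obtain ⟨N, ⟨eN⟩⟩ := GaloisObjects.exists_iso_quotientObj_of_isGaloisObj hΓ A₁.obj hA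
    exact GaloisObjects.isGaloisObj_of_iso_quotientObj hΓ _ N (e₁ ≪≫ eN)
  -- the fully faithful composite `B^temp(Γ)⁰ → CosetCat Γ → B^temp(Γ)`
  let Ψ : (F ⋙ CosetCat.toBTemp hΓ).FullyFaithful :=
    (CosetCat.equivConnectedPart hΓ).fullyFaithfulInverse.comp (Functor.FullyFaithful.ofFullyFaithful _)
  refine ⟨hA', ?_, ?_, ?_⟩
  · intro y
    exact surjective_of_isConnectedObj ((1 : Γ) : (F.obj A₁).carrier) (CosetCat.isConnectedObj_toBTemp hΓ _) _ y
  · intro s₁ s₂ h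
    obtain ⟨σ, hσ, hs⟩ := GaloisObjects.exists_autOver_apply_eq hΓ hA' ((CosetCat.toBTemp hΓ).map (F.map p)) s₁ s₂ h
    exact ⟨(temperedAction Γ).ι.mapIso σ, congrArg InducedCategory.Hom.hom hσ, hs⟩
  · intro σ hσ
    -- lift `σ` to `B^temp(Γ)` (full subcategory), then to `B^temp(Γ)⁰` through `Ψ`
    let σB : Aut ((CosetCat.toBTemp hΓ).obj (F.obj A₁)) :=
      (temperedAction Γ).fullyFaithfulι.preimageIso (X := (CosetCat.toBTemp hΓ).obj (F.obj A₁))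
        (Y := (CosetCat.toBTemp hΓ).obj (F.obj A₁)) σ
    have hσB : σB.hom.hom = σ.hom :=
      (temperedAction Γ).fullyFaithfulι.map_preimage (X := (CosetCat.toBTemp hΓ).obj (F.obj A₁))
        (Y := (CosetCat.toBTemp hΓ).obj (F.obj A₁)) σ.hom
    let g : Aut A₁ := Ψ.preimageIso σB
    have hg : (CosetCat.toBTemp hΓ).map (F.map g.hom) = σB.hom := Ψ.map_preimage σB.hom
    refine ⟨g, ?_, by rw [hg, hσB]⟩
    apply Ψ.map_injective
    change (CosetCat.toBTemp hΓ).map (F.map (g.hom ≫ p)) = (CosetCat.toBTemp hΓ).map (F.map p)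
    rw [F.map_comp, (CosetCat.toBTemp hΓ).map_comp, hg]
    apply (temperedAction Γ).ι.map_injective
    change σB.hom.hom ≫ ((CosetCat.toBTemp hΓ).map (F.map p)).hom = ((CosetCat.toBTemp hΓ).map (F.map p)).hom
    rw [hσB, hσ]

/-- **(Φ) for the small model: deck-invariant log-divisors descend along arrows out of Galois objects.**  For
`p : A₁ → B₁` in `B^temp(Γ)⁰` with `A₁` Galois, an element of `Φ₀(F A₁)` of `ofGaloisActionCosetCat hΓ A hZ` fixed by the
pull-backs along the automorphisms of `A₁` over `p` is a pull-back along `F p` (abc-iut-f-108's `phiZero_existsUnique_descent`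
transported by `cosetDescentData`). [cite: MochizukiEtTh2009, Def 3.3 p.73] -/
theorem ofGaloisActionCosetCat_Φ₀_descent {A₁ B₁ : ConnectedPart (BTemp Γ)} (p : A₁ ⟶ B₁) (hA : IsGaloisObj A₁.obj)
    (m : (ofGaloisActionCosetCat hΓ A hZ).Φ₀.obj (op ((CosetCat.equivConnectedPart hΓ).inverse.obj A₁)))
    (hm : ∀ g : Aut A₁, g.hom ≫ p = p →
      ((ofGaloisActionCosetCat hΓ A hZ).Φ₀.map ((CosetCat.equivConnectedPart hΓ).inverse.map g.hom).op).hom m = m) :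
    ∃ m' : (ofGaloisActionCosetCat hΓ A hZ).Φ₀.obj (op ((CosetCat.equivConnectedPart hΓ).inverse.obj B₁)),
      ((ofGaloisActionCosetCat hΓ A hZ).Φ₀.map ((CosetCat.equivConnectedPart hΓ).inverse.map p).op).hom m' = m := by
  obtain ⟨-, hf, hdeck, hlift⟩ := cosetDescentData hΓ p hA
  have hm' : ∀ σ : Aut ((CosetCat.toBTemp hΓ).obj ((CosetCat.equivConnectedPart hΓ).inverse.obj A₁)).obj,
      σ.hom ≫ ((CosetCat.toBTemp hΓ).map ((CosetCat.equivConnectedPart hΓ).inverse.map p)).hom =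
        ((CosetCat.toBTemp hΓ).map ((CosetCat.equivConnectedPart hΓ).inverse.map p)).hom →
      A.phiZeroPull σ.hom m = m := by
    intro σ hσ
    obtain ⟨g, hgp, hg⟩ := hlift σ hσ
    have h := hm g hgp
    rw [← hg]
    exact h
  obtain ⟨m', hm'', -⟩ := phiZero_existsUnique_descent _ hdeck A hf m hm'
  exact ⟨m', hm''⟩

/-- **(B) for the small model: deck-invariant log-meromorphic functions descend along arrows out of Galois objects**
(abc-iut-f-108's `bZero_existsUnique_descent` transported by `cosetDescentData`). [cite: MochizukiEtTh2009, Def 3.3 p.73] -/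
theorem ofGaloisActionCosetCat_B₀_descent {A₁ B₁ : ConnectedPart (BTemp Γ)} (p : A₁ ⟶ B₁) (hA : IsGaloisObj A₁.obj)
    (b : (ofGaloisActionCosetCat hΓ A hZ).B₀.obj (op ((CosetCat.equivConnectedPart hΓ).inverse.obj A₁)))
    (hb : ∀ g : Aut A₁, g.hom ≫ p = p →
      ((ofGaloisActionCosetCat hΓ A hZ).B₀.map ((CosetCat.equivConnectedPart hΓ).inverse.map g.hom).op).hom b = b) :
    ∃ b' : (ofGaloisActionCosetCat hΓ A hZ).B₀.obj (op ((CosetCat.equivConnectedPart hΓ).inverse.obj B₁)),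
      ((ofGaloisActionCosetCat hΓ A hZ).B₀.map ((CosetCat.equivConnectedPart hΓ).inverse.map p).op).hom b' = b := by
  obtain ⟨-, hf, hdeck, hlift⟩ := cosetDescentData hΓ p hA
  have hb' : ∀ σ : Aut ((CosetCat.toBTemp hΓ).obj ((CosetCat.equivConnectedPart hΓ).inverse.obj A₁)).obj,
      σ.hom ≫ ((CosetCat.toBTemp hΓ).map ((CosetCat.equivConnectedPart hΓ).inverse.map p)).hom =
        ((CosetCat.toBTemp hΓ).map ((CosetCat.equivConnectedPart hΓ).inverse.map p)).hom →
      A.bZeroPull σ.hom b = b := by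
    intro σ hσ
    obtain ⟨g, hgp, hg⟩ := hlift σ hσ
    have h := hb g hgp
    rw [← hg]
    exact h
  obtain ⟨b', hb'', -⟩ := bZero_existsUnique_descent _ hdeck A hf b hb'
  exact ⟨b', hb''⟩

end CosetDescent

end DivisorMonoids

/-! ## §1b The same descent engines for abc-iut-w5-d179's GENERALISED engine `TemperedFrobenioid.ofGenDiagonalBase` (the `Ÿ`-tower's
`Φ`; statements and proofs = FILE A §2–§3 verbatim with `GenDiagonalBase` for `DiagonalBase` — the two engines share `Φ = im(Φ₀^pf → Φ₀^rlf)`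
along `F` and the fibre-product `B`) -/

namespace TemperedFrobenioid

universe u₀ v₀ u' v'

section GenDescentEngine

variable {D₀ : Type u₀} [Category.{v₀} D₀] {dm : DivisorMonoids.{u₀, v₀, 0} D₀}
  (hpf : ∀ Y : D₀ᵒᵖ, IsPerfFactorialCof (dm.Φ₀.obj Y)) {D : Type u'} [Category.{v'} D] (P : GenDiagonalBase dm D)
  (hD : IsConnected D) (hD' : IsTotallyEpimorphic D) (hFSM : IsOfFSMType D) (R S : (Dᵒᵖ ⥤ CommMonCat.{0}) → Prop)

/-- The pull-back of `Φ` along `f` is the weak realification map `Φ₀(F f)^rlf` on underlying elements.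
[cite: MochizukiEtTh2009, Def 3.6 p.76] -/
theorem ofGenDiagonalBase_pull_divisorMonoid_coe {A B : D} (f : B ⟶ A)
    (z : (ofGenDiagonalBase hpf P hD hD' hFSM R S).divisorMonoid.obj (op A)) :
    (pull (ofGenDiagonalBase hpf P hD hD' hFSM R S).divisorMonoid f z).1 =
      rlfMapWeak dm.Φ₀ hpf (P.F.map f).op z.1 := rfl

/-- **(Φ) for `Φ = im(Φ₀^pf → Φ₀^rlf)` from descent in `Φ₀`**: if every deck-invariant element of `Φ₀(F A₁)` (decks = automorphisms
of `A₁` over `p`) descends along `Φ₀(F p)`, then every deck-invariant element of `Φ(A₁)` descends along `Φ(p)` — a deck-invariant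
`ι(m^{1/n})` has `m` deck-invariant (`Φ₀^pf → Φ₀^rlf` injective for weakly perf-factorial `Φ₀`, and `Φ₀` divisorial so `n`-th
powers are injective), and `ι(m′^{1/n})` pulls back to it for any `m′ ↦ m`. [cite: MochizukiEtTh2009, Rmk 4.1.1 p.88] -/
theorem ofGenDiagonalBase_divisorMonoid_descent_of_Φ₀ {A₁ B₁ : D} (p : A₁ ⟶ B₁)
    (hΦ₀ : ∀ m : dm.Φ₀.obj (op (P.F.obj A₁)),
      (∀ g : Aut A₁, g.hom ≫ p = p → (dm.Φ₀.map (P.F.map g.hom).op).hom m = m) →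
        ∃ m' : dm.Φ₀.obj (op (P.F.obj B₁)), (dm.Φ₀.map (P.F.map p).op).hom m' = m)
    (z : (ofGenDiagonalBase hpf P hD hD' hFSM R S).divisorMonoid.obj (op A₁))
    (hz : ∀ g : Aut A₁, g.hom ≫ p = p →
      pull (ofGenDiagonalBase hpf P hD hD' hFSM R S).divisorMonoid g.hom z = z) :
    ∃ z' : (ofGenDiagonalBase hpf P hD hD' hFSM R S).divisorMonoid.obj (op B₁),
      pull (ofGenDiagonalBase hpf P hD hD' hFSM R S).divisorMonoid p z' = z := by
  obtain ⟨a, ha⟩ := z.2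
  obtain ⟨⟨m, n⟩, rfl⟩ := Perfection.mk_surjective a
  -- `ha : ι(m^{1/n}) = z`
  have ha' : (hpf (op (P.F.obj A₁))).weak.toRealification (Perfection.mk m n) = z.1 := ha
  -- naturality of `ι` on a class `m^{1/n}`
  have hnat : ∀ {A B : D} (f : B ⟶ A) (x : dm.Φ₀.obj (op (P.F.obj A))) (k : ℕ+),
      rlfMapWeak dm.Φ₀ hpf (P.F.map f).op ((hpf (op (P.F.obj A))).weak.toRealification (Perfection.mk x k)) =
        (hpf (op (P.F.obj B))).weak.toRealification (Perfection.mk ((dm.Φ₀.map (P.F.map f).op).hom x) k) := by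
    intro A B f x k
    have h := DFunLike.congr_fun (rlfMapWeak_comp_toRealification dm.Φ₀ hpf (P.F.map f).op) (Perfection.mk x k)
    rw [MonoidHom.comp_apply, MonoidHom.comp_apply, Perfection.map_mk] at h
    exact h
  -- `m` is deck-invariant
  have hm : ∀ g : Aut A₁, g.hom ≫ p = p → (dm.Φ₀.map (P.F.map g.hom).op).hom m = m := by
    intro g hg
    have h1 := congrArg Subtype.val (hz g hg)
    rw [ofGenDiagonalBase_pull_divisorMonoid_coe, ← ha', hnat] at h1
    have h2 := PfImageWeak.toRealification_injective (hpf (op (P.F.obj A₁))).weak h1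
    obtain ⟨N, hN⟩ := Perfection.mk_eq_mk_iff.mp h2
    exact PreFrobenioid.pow_injective_of_isDivisorial (hpf (op (P.F.obj A₁))).weak.isDivisorial (Nat.mul_pos N.pos n.pos) hN
  obtain ⟨m', hm'⟩ := hΦ₀ m hm
  refine ⟨⟨(hpf (op (P.F.obj B₁))).weak.toRealification (Perfection.mk m' n), ⟨Perfection.mk m' n, rfl⟩⟩,
    Subtype.ext ?_⟩
  rw [ofGenDiagonalBase_pull_divisorMonoid_coe, ← ha']
  change rlfMapWeak dm.Φ₀ hpf (P.F.map p).op ((hpf (op (P.F.obj B₁))).weak.toRealification (Perfection.mk m' n)) = _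
  rw [hnat, hm']

/-- **`Φ(p)^gp` is injective** for the `ofGenDiagonalBase` engine: the pull-backs of `Φ` are injective (`Φsub_pull_injective`) and
`Φ` is cancellative (a submonoid of the divisorial `Φ₀^rlf`). [cite: MochizukiFrdI2008, Def. 1.1(ii) p.19] -/
theorem ofGenDiagonalBase_pullGp_divisorMonoid_injective {A₁ B₁ : D} (p : A₁ ⟶ B₁) :
    Injective (pullGp (ofGenDiagonalBase hpf P hD hD' hFSM R S).divisorMonoid p) := by
  haveI : IsCancelMul ((ofGenDiagonalBase hpf P hD hD' hFSM R S).divisorMonoid.obj (op B₁)) := isIntegral_iff_isCancelMul.mp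
    (PfImageWeak.isDivisorial_mrange_toRealification (hpf (op (P.F.obj B₁)))).isPreDivisorial.isIntegral
  haveI : IsCancelMul ((ofGenDiagonalBase hpf P hD hD' hFSM R S).divisorMonoid.obj (op A₁)) := isIntegral_iff_isCancelMul.mp
    (PfImageWeak.isDivisorial_mrange_toRealification (hpf (op (P.F.obj A₁)))).isPreDivisorial.isIntegral
  exact gpMap_injective _ (P.Φsub_pull_injective hpf p.op)

/-! ## §3 Galois descent of `B = B₀ ×_{(Φ₀^ℝ)^gp} Φ^gp` for the `ofGenDiagonalBase` engine -/

/-- `Φ₀(F A) → Φ(A)`, `m ↦ ι(m)` (codomain-restricted `Φ₀ → Φ₀^pf → Φ₀^rlf`). [cite: MochizukiEtTh2009, Def 3.6 p.76] -/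
theorem ofGenDiagonalBase_toR_mem (A : Dᵒᵖ) (m : dm.Φ₀.obj (op (P.F.obj A.unop))) :
    (hpf (op (P.F.obj A.unop))).weak.toRealification (Perfection.of _ m) ∈
      (ofGenDiagonalBase hpf P hD hD' hFSM R S).Φ.carrier A :=
  ⟨Perfection.of _ m, rfl⟩

/-- The inclusion `Φ(A)^gp → (Φ₀^ℝ)^gp(A)` is injective (`Φ(A) ⊆ Φ₀(FA)^rlf`, both cancellative).
[cite: MochizukiFrdI2008, Def. 1.1(ii) p.19] -/
theorem ofGenDiagonalBase_ΦgpToRlog_injective (A : Dᵒᵖ) :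
    Injective ((ofGenDiagonalBase hpf P hD hD' hFSM R S).ΦgpToRlog A) := by
  haveI : IsCancelMul ((ofGenDiagonalBase hpf P hD hD' hFSM R S).Φ.carrier A) := isIntegral_iff_isCancelMul.mp
    (PfImageWeak.isDivisorial_mrange_toRealification (hpf (op (P.F.obj A.unop)))).isPreDivisorial.isIntegral
  haveI : IsCancelMul ((RealifiedDivisorMonoids.ofRlfZWeak dm hpf).ΦR.obj
      ((ofGenDiagonalBase hpf P hD hD' hFSM R S).baseOp A)) :=
    IsPerfFactorialWeak.Rlf.isCancelMul (hpf (op (P.F.obj A.unop))).weak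
  exact gpMap_injective _ Subtype.val_injective

/-- **(B) for `B = B₀ ×_{(Φ₀^ℝ)^gp} Φ^gp` from descent in `B₀`**: if every deck-invariant element of `B₀(F A₁)` descends along
`B₀(F p)`, then every deck-invariant rational function `(b, ξ) ∈ B(A₁)` descends along `B(p)`: descend `b` to `b′`, take
`ξ′ := ι(div₀ b′) ∈ Φ(B₁)^gp`; the pair lies in `B(B₁)` by construction and pulls back to `(b, ξ)` because
`Φ(A₁)^gp → (Φ₀^ℝ)^gp(A₁)` is injective and both images equal `Div(b)`. [cite: MochizukiEtTh2009, Rmk 4.1.1 p.88] -/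
theorem ofGenDiagonalBase_ratFnFunctor_descent_of_B₀ {A₁ B₁ : D} (p : A₁ ⟶ B₁)
    (hB₀ : ∀ b : dm.B₀.obj (op (P.F.obj A₁)),
      (∀ g : Aut A₁, g.hom ≫ p = p → (dm.B₀.map (P.F.map g.hom).op).hom b = b) →
        ∃ b' : dm.B₀.obj (op (P.F.obj B₁)), (dm.B₀.map (P.F.map p).op).hom b' = b)
    (t : (ofGenDiagonalBase hpf P hD hD' hFSM R S).ratFnFunctor.obj (op A₁))
    (ht : ∀ g : Aut A₁, g.hom ≫ p = p →
      pull (ofGenDiagonalBase hpf P hD hD' hFSM R S).ratFnFunctor g.hom t = t) :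
    ∃ t' : (ofGenDiagonalBase hpf P hD hD' hFSM R S).ratFnFunctor.obj (op B₁),
      pull (ofGenDiagonalBase hpf P hD hD' hFSM R S).ratFnFunctor p t' = t := by
  -- descend the function
  have hb : ∀ g : Aut A₁, g.hom ≫ p = p → (dm.B₀.map (P.F.map g.hom).op).hom t.1.1 = t.1.1 := fun g hg =>
    congrArg (fun u : (ofGenDiagonalBase hpf P hD hD' hFSM R S).ratFn (op A₁) => u.1.1) (ht g hg)
  obtain ⟨b', hb'⟩ := hB₀ t.1.1 hb
  -- the divisor coordinate of the descended pair: `ι(div₀ b′) ∈ Φ(B₁)^gp`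
  let ι : dm.Φ₀.obj (op (P.F.obj B₁)) →* (ofGenDiagonalBase hpf P hD hD' hFSM R S).Φ.carrier (op B₁) :=
    ((hpf (op (P.F.obj B₁))).weak.toRealification.comp (Perfection.of _)).codRestrict _
      fun m => ofGenDiagonalBase_toR_mem hpf P hD hD' hFSM R S (op B₁) m
  have hι : ((ofGenDiagonalBase hpf P hD hD' hFSM R S).Φ.carrier (op B₁)).subtype.comp ι =
      (hpf (op (P.F.obj B₁))).weak.toRealification.comp (Perfection.of _) := rfl
  let ξ' : Algebra.GrothendieckGroup ((ofGenDiagonalBase hpf P hD hD' hFSM R S).Φ.carrier (op B₁)) := gpMap ι (dm.div₀ (op (P.F.obj B₁)) b')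
  have hmem : (b', ξ') ∈ (ofGenDiagonalBase hpf P hD hD' hFSM R S).ratFn (op B₁) := by
    change (RealifiedDivisorMonoids.ofRlfZWeak dm hpf).divΛ (op (P.F.obj B₁)) b' = (ofGenDiagonalBase hpf P hD hD' hFSM R S).ΦgpToRlog (op B₁) ξ'
    rw [RealifiedDivisorMonoids.ofRlfZWeak_divΛ_apply, toRlfNatTransWeak_app_hom, ← hι]
    exact gpMap_comp_apply'' ι ((ofGenDiagonalBase hpf P hD hD' hFSM R S).Φ.carrier (op B₁)).subtype _
  refine ⟨⟨(b', ξ'), hmem⟩, Subtype.ext (Prod.ext ?_ ?_)⟩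
  · -- first coordinate: `B₀(F p)(b′) = b`
    exact hb'
  · -- second coordinate, after `Φ(A₁)^gp ↪ (Φ₀^ℝ)^gp(A₁)`
    apply ofGenDiagonalBase_ΦgpToRlog_injective hpf P hD hD' hFSM R S (op A₁)
    change (ofGenDiagonalBase hpf P hD hD' hFSM R S).ΦgpToRlog (op A₁) (gpMap ((ofGenDiagonalBase hpf P hD hD' hFSM R S).Φ.pull p.op) ξ') = (ofGenDiagonalBase hpf P hD hD' hFSM R S).ΦgpToRlog (op A₁) t.1.2
    rw [(ofGenDiagonalBase hpf P hD hD' hFSM R S).ΦgpToRlog_pull, ← hmem, ← (RealifiedDivisorMonoids.ofRlfZWeak dm hpf).divΛ_natural, ← t.2]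
    exact congrArg _ hb'

/-- **`B(p)` is injective** for the `ofGenDiagonalBase` engine when the `B₀`-transition along `F p` is injective (and `Φ(p)^gp` is,
§2). [cite: MochizukiFrdI2008, Def. 1.1(ii) p.19] -/
theorem ofGenDiagonalBase_pull_ratFnFunctor_injective {A₁ B₁ : D} (p : A₁ ⟶ B₁)
    (hB₀inj : Injective (dm.B₀.map (P.F.map p).op).hom) :
    Injective (pull (ofGenDiagonalBase hpf P hD hD' hFSM R S).ratFnFunctor p) := by
  intro t₁ t₂ h
  have h1 := congrArg (fun u : (ofGenDiagonalBase hpf P hD hD' hFSM R S).ratFn (op A₁) => u.1.1) h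
  have h2 := congrArg (fun u : (ofGenDiagonalBase hpf P hD hD' hFSM R S).ratFn (op A₁) => u.1.2) h
  refine Subtype.ext (Prod.ext (hB₀inj h1) ?_)
  have hinj := ofGenDiagonalBase_pullGp_divisorMonoid_injective hpf P hD hD' hFSM R S p
  exact hinj h2

end GenDescentEngine

end TemperedFrobenioid

/-! ## §2 Remark 4.1.1 at the ℤ-tower §4 setting — NO hypothesis -/

namespace ZTowerTempered

variable {K : Type} [Field K] (X : SemiGraphs.TemperedArithmeticGroup.{0} K) (φ : X.Pi →* Multiplicative ℤ)
  (R S : ((ConnectedPart (BTemp X.Pi))ᵒᵖ ⥤ CommMonCat.{0}) → Prop)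
  (NH : Subgroup (Field.absoluteGaloisGroup K) → (ZTowerTempered.temperedFrobenioid X φ R S).category → ℕ+ → Prop)
  (M : OpenNormalSubgroup X.Pi)

/-- **(Φ) at the ℤ-tower, NO hypothesis**: along every arrow `p : A₁ → B₁` of `B^temp(Π^tp_X)⁰` out of a Galois object, the
deck-invariant elements of `Φ(A₁) = im(Φ₀(Π/U)^pf → Φ₀(Π/U)^rlf)` of the ℤ-tower's tempered Frobenioid descend along `Φ(p)`, and
`Φ(p)^gp` is injective. [cite: MochizukiEtTh2009, Rmk 4.1.1 p.88] -/
theorem divisorMonoid_galoisDescent ⦃A₁ B₁ : ConnectedPart (BTemp X.Pi)⦄ (p : A₁ ⟶ B₁) (hA : SemiGraphs.IsGaloisObj A₁.obj) :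
    (∀ z : (ZTowerTempered.temperedFrobenioid X φ R S).divisorMonoid.obj (op A₁),
        (∀ g : Aut A₁, g.hom ≫ p = p → pull (ZTowerTempered.temperedFrobenioid X φ R S).divisorMonoid g.hom z = z) →
          ∃ z' : (ZTowerTempered.temperedFrobenioid X φ R S).divisorMonoid.obj (op B₁),
            pull (ZTowerTempered.temperedFrobenioid X φ R S).divisorMonoid p z' = z) ∧
      Injective (pullGp (ZTowerTempered.temperedFrobenioid X φ R S).divisorMonoid p) :=
  ⟨fun z hz => TemperedFrobenioid.ofDiagonalBase_divisorMonoid_descent_of_Φ₀ (hpf X φ) (diagonalBase X φ) _ _ _ R S p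
      (fun m hm => DivisorMonoids.ofGaloisActionCosetCat_Φ₀_descent X.isTempered (ZTower.action φ) TateTower.cuspLaws p hA m hm)
      z hz,
    TemperedFrobenioid.ofDiagonalBase_pullGp_divisorMonoid_injective (hpf X φ) (diagonalBase X φ) _ _ _ R S p⟩

/-- **(B) at the ℤ-tower, NO hypothesis**: along every arrow out of a Galois object, the deck-invariant rational functions
`(b, ξ) ∈ B(A₁) = B₀ ×_{(Φ₀^ℝ)^gp} Φ^gp` descend along `B(p)`, and `B(p)` is injective. [cite: MochizukiEtTh2009, Rmk 4.1.1 p.88] -/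
theorem ratFnFunctor_galoisDescent ⦃A₁ B₁ : ConnectedPart (BTemp X.Pi)⦄ (p : A₁ ⟶ B₁) (hA : SemiGraphs.IsGaloisObj A₁.obj) :
    (∀ t : (ZTowerTempered.temperedFrobenioid X φ R S).ratFnFunctor.obj (op A₁),
        (∀ g : Aut A₁, g.hom ≫ p = p → pull (ZTowerTempered.temperedFrobenioid X φ R S).ratFnFunctor g.hom t = t) →
          ∃ t' : (ZTowerTempered.temperedFrobenioid X φ R S).ratFnFunctor.obj (op B₁),
            pull (ZTowerTempered.temperedFrobenioid X φ R S).ratFnFunctor p t' = t) ∧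
      Injective (pull (ZTowerTempered.temperedFrobenioid X φ R S).ratFnFunctor p) :=
  ⟨fun t ht => TemperedFrobenioid.ofDiagonalBase_ratFnFunctor_descent_of_B₀ (hpf X φ) (diagonalBase X φ) _ _ _ R S p
      (fun b hb => DivisorMonoids.ofGaloisActionCosetCat_B₀_descent X.isTempered (ZTower.action φ) TateTower.cuspLaws p hA b hb)
      t ht,
    TemperedFrobenioid.ofDiagonalBase_pull_ratFnFunctor_injective (hpf X φ) (diagonalBase X φ) _ _ _ R S p
      (DivisorMonoids.ofGaloisActionCosetCat_B₀_map_injective X.isTempered _ _ _)⟩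

/-- **[EtTh] Remark 4.1.1 at the genuine ℤ-tower §4 setting — HYPOTHESIS-FREE.**  For every [SemiAnbd] Ex. 3.10 datum
`X` (`Π^tp_X ↠ G_K`), every `φ : Π^tp_X → ℤ`, every vocabulary `R`, `S`, every `(N,H)`-slot `NH` and every open normal `M`
(`A_⊙ := (Π^tp_X/M, 0)`): in the §4 bi-Kummer setting `ZTowerTempered.setting X φ R S NH M` (genuine base `B^temp(Π^tp_X)⁰`, genuine
Def. 3.3 (iii) divisor / function data of the ℤ-tower) EVERY morphism `α : A → B` of base-Frobenius type is a categorical quotient of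
`A` by `G · μ_N(A)` among the Frobenius-trivial objects (abc-iut-L2-t3's typed `Remark411`, both conjuncts): abc-iut-f-108's reduction
with (Q) by [SemiAnbd] Rmk. 3.1.3 and (Φ), (B) by Galois descent in the tower's `Γ`-set data (Prop. 3.4 (ii)'s mechanism, as print
says). [cite: MochizukiEtTh2009, Rmk 4.1.1 p.88] -/
theorem remark411_setting : (ZTowerTempered.setting X φ R S NH M).Remark411 :=
  (ZTowerTempered.setting X φ R S NH M).remark411_ofConnectedPart_treeCatVocab_of_galoisDescent (fun _ h => h)
    (divisorMonoid_galoisDescent X φ R S) (ratFnFunctor_galoisDescent X φ R S)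

end ZTowerTempered

/-! ## §3 Remark 4.1.1 at the Tate-tower (`Ÿ`-skeleton) §4 setting — NO hypothesis -/

namespace ThetaTowerTempered

variable {K : Type} [Field K] (X : SemiGraphs.TemperedArithmeticGroup.{0} K) (φ : X.Pi →* Multiplicative ℤ)
  (R S : ((ConnectedPart (BTemp X.Pi))ᵒᵖ ⥤ CommMonCat.{0}) → Prop)
  (NH : Subgroup (Field.absoluteGaloisGroup K) → (ThetaTowerTempered.temperedFrobenioid X φ R S).category → ℕ+ → Prop)
  (M : OpenNormalSubgroup X.Pi)

/-- **(Φ) at the `Ÿ`-tower, NO hypothesis** (as `ZTowerTempered.divisorMonoid_galoisDescent`, generalised engine).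
[cite: MochizukiEtTh2009, Rmk 4.1.1 p.88] -/
theorem divisorMonoid_galoisDescent ⦃A₁ B₁ : ConnectedPart (BTemp X.Pi)⦄ (p : A₁ ⟶ B₁) (hA : SemiGraphs.IsGaloisObj A₁.obj) :
    (∀ z : (ThetaTowerTempered.temperedFrobenioid X φ R S).divisorMonoid.obj (op A₁),
        (∀ g : Aut A₁, g.hom ≫ p = p → pull (ThetaTowerTempered.temperedFrobenioid X φ R S).divisorMonoid g.hom z = z) →
          ∃ z' : (ThetaTowerTempered.temperedFrobenioid X φ R S).divisorMonoid.obj (op B₁),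
            pull (ThetaTowerTempered.temperedFrobenioid X φ R S).divisorMonoid p z' = z) ∧
      Injective (pullGp (ThetaTowerTempered.temperedFrobenioid X φ R S).divisorMonoid p) :=
  ⟨fun z hz => TemperedFrobenioid.ofGenDiagonalBase_divisorMonoid_descent_of_Φ₀ (hpf X φ) (genDiagonalBase X φ) _ _ _ R S p
      (fun m hm => DivisorMonoids.ofGaloisActionCosetCat_Φ₀_descent X.isTempered (TateTowerTheta.action φ) TateTowerTheta.cuspLaws
        p hA m hm)
      z hz,
    TemperedFrobenioid.ofGenDiagonalBase_pullGp_divisorMonoid_injective (hpf X φ) (genDiagonalBase X φ) _ _ _ R S p⟩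

/-- **(B) at the `Ÿ`-tower, NO hypothesis.** [cite: MochizukiEtTh2009, Rmk 4.1.1 p.88] -/
theorem ratFnFunctor_galoisDescent ⦃A₁ B₁ : ConnectedPart (BTemp X.Pi)⦄ (p : A₁ ⟶ B₁) (hA : SemiGraphs.IsGaloisObj A₁.obj) :
    (∀ t : (ThetaTowerTempered.temperedFrobenioid X φ R S).ratFnFunctor.obj (op A₁),
        (∀ g : Aut A₁, g.hom ≫ p = p → pull (ThetaTowerTempered.temperedFrobenioid X φ R S).ratFnFunctor g.hom t = t) →
          ∃ t' : (ThetaTowerTempered.temperedFrobenioid X φ R S).ratFnFunctor.obj (op B₁),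
            pull (ThetaTowerTempered.temperedFrobenioid X φ R S).ratFnFunctor p t' = t) ∧
      Injective (pull (ThetaTowerTempered.temperedFrobenioid X φ R S).ratFnFunctor p) :=
  ⟨fun t ht => TemperedFrobenioid.ofGenDiagonalBase_ratFnFunctor_descent_of_B₀ (hpf X φ) (genDiagonalBase X φ) _ _ _ R S p
      (fun b hb => DivisorMonoids.ofGaloisActionCosetCat_B₀_descent X.isTempered (TateTowerTheta.action φ) TateTowerTheta.cuspLaws
        p hA b hb)
      t ht,
    TemperedFrobenioid.ofGenDiagonalBase_pull_ratFnFunctor_injective (hpf X φ) (genDiagonalBase X φ) _ _ _ R S p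
      (DivisorMonoids.ofGaloisActionCosetCat_B₀_map_injective X.isTempered _ _ _)⟩

/-- **[EtTh] Remark 4.1.1 at the genuine Tate-tower (`Ÿ`-skeleton) §4 setting — HYPOTHESIS-FREE**: in
`ThetaTowerTempered.setting X φ R S NH M` (genuine base `B^temp(Π^tp_X)⁰`, genuine Def. 3.3 (iii) data of the Tate tower with
cusps) every morphism of base-Frobenius type is a categorical quotient by `G · μ_N(A)` among the Frobenius-trivial objects
(typed `Remark411`). [cite: MochizukiEtTh2009, Rmk 4.1.1 p.88] -/
theorem remark411_setting : (ThetaTowerTempered.setting X φ R S NH M).Remark411 :=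
  (ThetaTowerTempered.setting X φ R S NH M).remark411_ofConnectedPart_treeCatVocab_of_galoisDescent (fun _ h => h)
    (divisorMonoid_galoisDescent X φ R S) (ratFnFunctor_galoisDescent X φ R S)

end ThetaTowerTempered

end Literature.AnabelianGeometry.EtaleTheta

end
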